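import Mathlib
import Literature.MathematicalPhysics.QuantumFieldTheory.GaugeOSData
import Summits.QuantumFields.YangMills.Theses.DirichletWindow
import Summits.QuantumFields.YangMills.Theorems.DirichletWindowCriticalityOfXiDiverges
import HarnessLib

/-!
# `ContinuumLegGivenGap` (stmt-QuantumFields-15828), line `Sketch` (reshape 7/8): `stub_critical`

Support file for the crux item stmt-QuantumFields-15828 (registered stub `stub_critical` of line
`Sketch`): **criticality along a locked sequence**. At a compact simple `(G, r)` (Borel σ-algebra),
assume the crux's hypothesis (above `β₀`, at each coupling some rate `m(β) > 0`, some volume threshold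
and per-pair constants bound the connected time correlations on the tori `(ℤ/(2S+1))⁴`) and a
sequence of couplings `β_k → +∞` with rates `m̂_k > 0`, thresholds `S₁ k` and `k`-UNIFORM pair
constants. Then `m̂_k → 0`.

Proof: if not, `m̂_k ≥ m₀ > 0` frequently. Splice a rate FUNCTION on `[β₀, ∞)`: `m'(b) := m₀` at
couplings `b = β_k` carrying such an index (admissible there: the uniform constants at rate `m̂_k ≥ m₀`,
threshold `S₁ k`), and the crux's own rate elsewhere. `DirichletWindow.XiDiverges` (stmt-8941, a
hypothesis, by name) and the landed glue `criticalityOfXiDiverges_proof` (stmt-12318) give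
`m'(b) < m₀` for all large `b`, contradicting `m'(β_k) = m₀` at a large such `k`.

Pure logic over the landed glue; no definitions, no facts. [folklore]
-/

noncomputable section

namespace Summit.QuantumFields.YangMills.Theorems.ContinuumLegGivenGap

open Filter Topology
open Literature.MathematicalPhysics.QuantumFieldTheory
open Summit.QuantumFields.YangMills.Theses

/-- **`stub_critical`** (registered stub of stmt-QuantumFields-15828, line `Sketch`): under
`XiDiverges`, at a compact simple `(G, r)` with the crux's per-β torus clustering above `β₀`, every
sequence of couplings `β_k → +∞` equipped with rates `m̂_k > 0`, thresholds and `k`-uniform pair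
constants has `m̂_k → 0` (splice `m̂` into the crux's rate function and apply the landed
`criticalityOfXiDiverges_proof`). [folklore] -/
theorem stub_critical :
    DirichletWindow.XiDiverges →
    ∀ (G : Type) [Group G] [TopologicalSpace G] [IsTopologicalGroup G] [CompactSpace G]
      [MeasurableSpace G] [BorelSpace G], IsCompactSimpleLieGroup G → ∀ r : LatticeRep G,
      (∃ β₀ : ℝ, ∀ β : ℝ, β₀ ≤ β → ∃ m : ℝ, 0 < m ∧ ∃ S₁ : ℕ, ∀ A B : YMSpecies G, ∃ C : ℝ,
        ∀ S n : ℕ, S₁ ≤ S → n ≤ S →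
          |latticeConnectedCorr r.ρ β (2 * S + 1) A.F B.F n| ≤ C * Real.exp (-(m * n))) →
      ∀ (β : ℕ → ℝ) (mh : ℕ → ℝ) (S₁ : ℕ → ℕ), Tendsto β atTop atTop → (∀ k, 0 < mh k) →
        (∀ A B : YMSpecies G, ∃ C : ℝ, ∀ k S n : ℕ, S₁ k ≤ S → n ≤ S →
          |latticeConnectedCorr r.ρ (β k) (2 * S + 1) A.F B.F n| ≤ C * Real.exp (-(mh k * n))) →
        Tendsto mh atTop (𝓝 0) := by
  intro hXi G _ _ _ _ _ _ hG r hGap β mh S₁ hβ hmh hunif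
  borelize G
  refine tendsto_order.2 ⟨fun a ha => Eventually.of_forall fun k => ha.trans (hmh k), fun m₀ hm₀ => ?_⟩
  by_contra hnot
  have hfreq : ∃ᶠ k in atTop, m₀ ≤ mh k := by
    simpa only [Filter.not_eventually, not_lt] using hnot
  obtain ⟨β₀, hβ₀⟩ := hGap
  classical
  -- the spliced rate function on `[β₀, ∞)`
  let m' : ℝ → ℝ := fun b =>
    if ∃ k, β k = b ∧ m₀ ≤ mh k then m₀ else if h : β₀ ≤ b then Classical.choose (hβ₀ b h) else 1
  have hadm : ∀ b : ℝ, β₀ ≤ b → 0 < m' b ∧ (∃ S₀ : ℕ, ∀ A B : YMSpecies G, ∃ C : ℝ, ∀ S n : ℕ,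
      S₀ ≤ S → n ≤ S →
        |latticeConnectedCorr r.ρ b (2 * S + 1) A.F B.F n| ≤ C * Real.exp (-(m' b * n))) := by
    intro b hb
    by_cases hk : ∃ k, β k = b ∧ m₀ ≤ mh k
    · have hm'eq : m' b = m₀ := if_pos hk
      obtain ⟨k, rfl, hk'⟩ := hk
      rw [hm'eq]
      refine ⟨hm₀, S₁ k, fun A B => ?_⟩
      obtain ⟨C, hC⟩ := hunif A B
      refine ⟨max C 0, fun S n hS hn => (hC k S n hS hn).trans ?_⟩
      have hn0 : (0 : ℝ) ≤ n := Nat.cast_nonneg n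
      have hexp : Real.exp (-(mh k * n)) ≤ Real.exp (-(m₀ * n)) :=
        Real.exp_le_exp.2 (neg_le_neg (mul_le_mul_of_nonneg_right hk' hn0))
      calc C * Real.exp (-(mh k * n)) ≤ max C 0 * Real.exp (-(mh k * n)) :=
            mul_le_mul_of_nonneg_right (le_max_left _ _) (Real.exp_pos _).le
        _ ≤ max C 0 * Real.exp (-(m₀ * n)) := mul_le_mul_of_nonneg_left hexp (le_max_right _ _)
    · have hm'eq : m' b = Classical.choose (hβ₀ b hb) := by
        simp only [m', if_neg hk, dif_pos hb]
      rw [hm'eq]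
      exact Classical.choose_spec (hβ₀ b hb)
  have hcrit : ∀ᶠ b : ℝ in atTop, m' b < m₀ :=
    Summit.QuantumFields.YangMills.Theorems.criticalityOfXiDiverges_proof hXi G hG r β₀ m' hadm m₀ hm₀
  obtain ⟨k, hk1, hk2⟩ := ((hβ.eventually hcrit).and_frequently hfreq).exists
  have hmk : m' (β k) = m₀ := if_pos ⟨k, rfl, hk2⟩
  exact (lt_irrefl m₀) (hmk ▸ hk1)

end Summit.QuantumFields.YangMills.Theorems.ContinuumLegGivenGap

end
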